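import Summits.HodgeConjecture.HodgeConjecture.Theorems.F0P2nBorelCharactersUnipotent
import HarnessLib

/-!
# H2 (a) of the (N-H-ii) road: every character of the Borel `B = T N` of `U(Φ₂)(R)` kills `N`; hence `δ_B` and `δ_B^{1/2}` are
# trivial on `N(L⁺_v)` for the quasi-split `U(1,1) = U(Φ₂)` at a finite place — the `N = 2` twin of ★ `F0P2nBorelCharactersUnipotent`

Cell hodgecm-mathlib F0∕P2 (free hand for the F0∕P3b desk), crux `stmt-HodgeConjecture-24833` (`H413`), line «CMCharIdentityTest» stub
`stub_hPrincipalSeriesJH` (ED. 10), road H0–H5 step **H2**: the hypothesis `hδ` of ★ `Representation.frobenius_normalizedInd` ∕ ★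
`frobenius_normalizedInd_holds` (Frobenius reciprocity `Hom_G(π, i(χ)) ≃ Hom_T(r_B π, χ)`) for `G = U(Φ₂)(L⁺_v)`, in the VERBATIM shape of ★
`F0P2nBorelCharactersUnipotent.deltaChar_cmBorel_eq_one` with `3 ↦ 2`.
PURELY ALGEBRAIC and SHORTER than `N = 3` (`N` is abelian): over any commutative ring `R` with `2, 3 ∈ Rˣ` and any ring endomorphism `σ`, for
`u = u(x) = [[1, x], [0, 1]] ∈ N ≤ U(σ, Φ₂)(R)` and the torus element `t_α = d(α, α⁻¹)` (`σ α = α`; it is unitary for `Φ₂ = antidiag(1, 1)`),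
`t_α u t_α⁻¹ = u(α² x) = u ^ (α²)`; so a homomorphism `χ : B → C` to a commutative group has `χ u ^ 4 = χ u = χ u ^ 9` (`α = 2, 3`), whence
`χ u ^ 3 = χ u ^ 8 = 1` and `χ u = 1` ([Rogawski1990, §1.10]; the `U(3)` proof's Steps C–D are not needed).

* §1 `2 × 2` bookkeeping: `Φ₂ = !![0, 1; 1, 0]`, `d(α, α⁻¹) ∈ U(σ, Φ₂)`, conjugation by a diagonal, `u ∈ N ⇒ u = !![1, u₀₁; 0, 1]`, powers of `u(x)`.
* §2 `map_eq_one_of_mem_unipotentU_two` (generic), `…_of_eq`, `map_eq_map_proj_two_of_eq` (characters of `B` factor through the Levi projection).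
* §3 the CM Borel ★ `cmBorelTriple L 2 v` (`R = ∏_{w ∣ v} L_w`): `map_eq_one_of_mem_cmUnipotentU_two`, **`rootDeltaChar_cmBorel_two_eq_one`**,
  **`deltaChar_cmBorel_two_eq_one`** (the `hδ` of ★ `frobenius_normalizedInd` verbatim), `rootDeltaChar_cmBorel_two_eq_proj`, and J2 in `proj` form
  for ANY torus character `χ₂` (`exists_intertwiningMap_cmPrincipalSeries_two_of_functional_proj`, over ★ §3 of the `N = 3` file, which is generic).
HONEST LABEL: HC_CM is proved only modulo the 2 remaining named inputs (hLiu418, h413) until rung 0 closes; this file discharges neither.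
References: [Rogawski1990, §1.10 p. 9, §12.1 p. 171]; [BernsteinZelevinsky1977, 1.8, §2.3]; [BernsteinZelevinsky1976, Prop. 2.28].
-/

set_option autoImplicit false
set_option linter.dupNamespace false

noncomputable section

open NumberField IsDedekindDomain
open scoped MatrixGroups

namespace Summit.HodgeConjecture.HodgeConjecture.Cruxes.H413.F0P3bBorelCharactersUnipotentTwo

open Literature.NumberTheory.Automorphic Literature.NumberTheory.Automorphic.UnitaryGroup
open Summit.HodgeConjecture.HodgeConjecture.Cruxes.H413.F0P2nBorelCharactersUnipotent

/-! ## §1 `2 × 2` bookkeeping -/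

section Generic

variable {R : Type*} [CommRing R]

/-- The antidiagonal form `Φ₂ = antidiag(1, 1)` as an explicit `2 × 2` matrix. [cite: Rogawski1990, §1.9 p. 8] -/
theorem antidiagonal_two_over_eq : (StdForm.antidiagonal 2).over R = !![0, 1; 1, 0] := by
  ext i j
  simp only [StdForm.over, Matrix.map_apply, StdForm.antidiagonal_J_apply]
  fin_cases i <;> fin_cases j <;> simp

variable (σ : R →+* R)

/-- The torus element `d(α, α⁻¹)` (`α ∈ Rˣ`, `σ α = α`) lies in `U(σ, Φ₂)(R)` (`σ(α) · α⁻¹ = 1`). [cite: Rogawski1990, §1.10 p. 9] -/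
theorem glDiagonal_two_mem_unitaryGroupOfForm (α : Rˣ) (hα : σ α = α) :
    glDiagonal 2 R ![α, α⁻¹] ∈ unitaryGroupOfForm σ ((StdForm.antidiagonal 2).over R) := by
  have hα' : σ ((α⁻¹ : Rˣ) : R) = ((α⁻¹ : Rˣ) : R) := by
    have h1 : (α : R) * σ ((α⁻¹ : Rˣ) : R) = 1 := by rw [← hα, ← map_mul, Units.mul_inv, map_one]
    calc σ ((α⁻¹ : Rˣ) : R) = ((α⁻¹ : Rˣ) : R) * ((α : R) * σ ((α⁻¹ : Rˣ) : R)) := by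
          rw [← mul_assoc, Units.inv_mul, one_mul]
      _ = ((α⁻¹ : Rˣ) : R) := by rw [h1, mul_one]
  rw [mem_unitaryGroupOfForm_iff, antidiagonal_two_over_eq, coe_glDiagonal]
  ext i j
  fin_cases i <;> fin_cases j <;>
    simp [Matrix.mul_apply, Fin.sum_univ_two, Matrix.diagonal, Matrix.map_apply, Matrix.transpose_apply, hα, hα']

omit σ in
/-- Conjugation by a diagonal `2 × 2` matrix multiplies the `(i, j)` entry by `dᵢ dⱼ⁻¹`. [folklore] -/
theorem coe_glDiagonal_two_mul_mul_inv_apply (d : Fin 2 → Rˣ) (g : GL (Fin 2) R) (i j : Fin 2) :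
    ((glDiagonal 2 R d * g * (glDiagonal 2 R d)⁻¹ : GL (Fin 2) R) : Matrix (Fin 2) (Fin 2) R) i j =
      (d i : R) * (g : Matrix (Fin 2) (Fin 2) R) i j * ((d j)⁻¹ : Rˣ) := by
  rw [← map_inv, Units.val_mul, Units.val_mul, coe_glDiagonal, coe_glDiagonal, Matrix.mul_diagonal,
    Matrix.diagonal_mul, Pi.inv_apply]

/-- An element of `N ≤ U(σ, Φ₂)(R)` is `u(x) = [[1, x], [0, 1]]` with `x` its `(0,1)` entry. [cite: Rogawski1990, §1.10 p. 9] -/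
theorem coe_eq_of_mem_unipotentU_two {u : ↥(unitaryGroupOfForm σ ((StdForm.antidiagonal 2).over R))}
    (hu : u ∈ unipotentU σ ((StdForm.antidiagonal 2).over R)) :
    ((u : GL (Fin 2) R) : Matrix (Fin 2) (Fin 2) R) = !![1, ((u : GL (Fin 2) R) : Matrix (Fin 2) (Fin 2) R) 0 1; 0, 1] := by
  obtain ⟨hT, hD⟩ := (mem_unipotentU_iff u).1 hu
  have h10 : ((u : GL (Fin 2) R) : Matrix (Fin 2) (Fin 2) R) 1 0 = 0 := hT (by decide)
  ext i j
  fin_cases i <;> fin_cases j <;> simp [hD 0, hD 1, h10]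

omit σ in
/-- Powers of `u(x)`: `u(x)ⁿ = u(n x)`. [cite: Rogawski1990, §1.10 p. 9] -/
theorem unipotent_two_pow (x : R) (n : ℕ) :
    (!![1, x; 0, 1] : Matrix (Fin 2) (Fin 2) R) ^ n = !![1, (n : R) * x; 0, 1] := by
  induction n with
  | zero => rw [pow_zero, Nat.cast_zero, zero_mul, Matrix.one_fin_two]
  | succ n ih =>
    rw [pow_succ, ih, Matrix.mul_fin_two]
    simp only [mul_one, mul_zero, zero_mul, add_zero, zero_add, one_mul, Nat.cast_succ, add_mul, add_comm x]

end Generic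

/-! ## §2 Every character of `B ≤ U(σ, Φ₂)(R)` is trivial on `N` -/

section Characters

variable {R : Type*} [CommRing R] (σ : R →+* R)

/-- **Every character of `B` kills `N`** (`2, 3 ∈ Rˣ`): for `χ : B →* C`, `C` a commutative group, and `u ∈ N ≤ B ≤ U(σ, Φ₂)(R)`,
`χ u = 1` — `t_α u t_α⁻¹ = u ^ (α²)` for `t_α = d(α, α⁻¹)`, `α = 2, 3`. [cite: Rogawski1990, §1.10 p. 9] [cite: BernsteinZelevinsky1977, 1.8] -/
theorem map_eq_one_of_mem_unipotentU_two (h2 : IsUnit (2 : R)) (h3 : IsUnit (3 : R)) {C : Type*} [CommGroup C]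
    (χ : ↥(borelU σ ((StdForm.antidiagonal 2).over R)) →* C)
    {u : ↥(unitaryGroupOfForm σ ((StdForm.antidiagonal 2).over R))} (hu : u ∈ unipotentU σ ((StdForm.antidiagonal 2).over R)) :
    χ ⟨u, unipotentU_le_borelU σ _ hu⟩ = 1 := by
  have hσ2 : σ ((h2.unit : Rˣ) : R) = (h2.unit : Rˣ) := by rw [IsUnit.unit_spec, map_ofNat]
  have hσ3 : σ ((h3.unit : Rˣ) : R) = (h3.unit : Rˣ) := by rw [IsUnit.unit_spec, map_ofNat]
  -- `t_α ∈ B`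
  have tmemB : ∀ (α : Rˣ) (hα : σ α = α),
      (⟨glDiagonal 2 R ![α, α⁻¹], glDiagonal_two_mem_unitaryGroupOfForm σ α hα⟩ :
        ↥(unitaryGroupOfForm σ ((StdForm.antidiagonal 2).over R))) ∈ borelU σ ((StdForm.antidiagonal 2).over R) := by
    intro α hα
    rw [mem_borelU_iff]
    change (((glDiagonal 2 R ![α, α⁻¹]) : GL (Fin 2) R) : Matrix (Fin 2) (Fin 2) R).BlockTriangular id
    rw [coe_glDiagonal]
    exact Matrix.blockTriangular_diagonal _
  -- Step A: `t_α u t_α⁻¹ = u ^ n` whenever `(n : R) = α²`; hence `χ u ^ n = χ u`.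
  have stepA : ∀ (α : Rˣ) (hα : σ α = α) (n : ℕ) (hn : (n : R) = α * α),
      χ ⟨u, unipotentU_le_borelU σ _ hu⟩ ^ n = χ ⟨u, unipotentU_le_borelU σ _ hu⟩ := by
    intro α hα n hn
    set t : ↥(unitaryGroupOfForm σ ((StdForm.antidiagonal 2).over R)) :=
      ⟨glDiagonal 2 R ![α, α⁻¹], glDiagonal_two_mem_unitaryGroupOfForm σ α hα⟩ with htdef
    have htB : t ∈ borelU σ ((StdForm.antidiagonal 2).over R) := tmemB α hα
    have hconj : t * u * t⁻¹ = u ^ n := by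
      apply Subtype.ext
      apply Units.ext
      rw [Subgroup.coe_mul, Subgroup.coe_mul, Subgroup.coe_inv, Subgroup.coe_pow, Units.val_pow_eq_pow_val,
        coe_eq_of_mem_unipotentU_two σ hu, unipotent_two_pow]
      ext i j
      rw [htdef, coe_glDiagonal_two_mul_mul_inv_apply, coe_eq_of_mem_unipotentU_two σ hu]
      fin_cases i <;> fin_cases j <;> simp [hn]
      ring
    have hB : (⟨t, htB⟩ : ↥(borelU σ ((StdForm.antidiagonal 2).over R))) * ⟨u, unipotentU_le_borelU σ _ hu⟩ * ⟨t, htB⟩⁻¹ =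
        ⟨u, unipotentU_le_borelU σ _ hu⟩ ^ n := Subtype.ext hconj
    have := congrArg χ hB
    rw [map_mul, map_mul, map_inv, mul_right_comm, mul_inv_cancel, one_mul, map_pow] at this
    exact this.symm
  -- Step B: `χ u ^ 4 = χ u = χ u ^ 9`, so `χ u = 1`.
  set x := χ ⟨u, unipotentU_le_borelU σ _ hu⟩ with hx
  have h4 : x ^ 4 = x := stepA h2.unit hσ2 4 (by rw [IsUnit.unit_spec]; norm_num)
  have h9 : x ^ 9 = x := stepA h3.unit hσ3 9 (by rw [IsUnit.unit_spec]; norm_num)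
  have h3' : x ^ 3 = 1 := mul_right_cancel (a := x ^ 3) (b := x) (c := 1) (by rw [← pow_succ, h4, one_mul])
  have h8 : x ^ 8 = 1 := mul_right_cancel (a := x ^ 8) (b := x) (c := 1) (by rw [← pow_succ, h9, one_mul])
  calc x = x ^ 8 * x := by rw [h8, one_mul]
    _ = x ^ 9 := (pow_succ x 8).symm
    _ = (x ^ 3) ^ 3 := by rw [← pow_mul]
    _ = 1 := by rw [h3', one_pow]

/-- The same for a form `J` GIVEN as `Φ₂` by an equation (the shape of ★ `borelTriple σ J hJ` ∕ ★ `cmBorelTriple L 2 v`).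
[cite: Rogawski1990, §1.10 p. 9] [cite: BernsteinZelevinsky1977, 1.8] -/
theorem map_eq_one_of_mem_unipotentU_two_of_eq {J : Matrix (Fin 2) (Fin 2) R} (hJ : J = (StdForm.antidiagonal 2).over R)
    (h2 : IsUnit (2 : R)) (h3 : IsUnit (3 : R)) {C : Type*} [CommGroup C] (χ : ↥(borelU σ J) →* C)
    {u : ↥(unitaryGroupOfForm σ J)} (hu : u ∈ unipotentU σ J) : χ ⟨u, unipotentU_le_borelU σ J hu⟩ = 1 := by
  subst hJ
  exact map_eq_one_of_mem_unipotentU_two σ h2 h3 χ hu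

/-- **Characters of `B ≤ U(σ, Φ₂)(R)` factor through the Levi projection**: `χ p = χ (proj p)` (`p = proj p · n`, `χ` kills `N`).
[cite: Rogawski1990, §1.10 p. 9] [cite: BernsteinZelevinsky1977, 1.8] -/
theorem map_eq_map_proj_two_of_eq {J : Matrix (Fin 2) (Fin 2) R} (hJ : J = (StdForm.antidiagonal 2).over R)
    (h2 : IsUnit (2 : R)) (h3 : IsUnit (3 : R)) {C : Type*} [CommGroup C] (χ : ↥(borelTriple σ J hJ).P →* C)
    (p : ↥(borelTriple σ J hJ).P) :
    χ p = χ ⟨((borelTriple σ J hJ).proj p : ↥(unitaryGroupOfForm σ J)), (borelTriple σ J hJ).M_le ((borelTriple σ J hJ).proj p).2⟩ := by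
  set m : ↥(borelTriple σ J hJ).P :=
    ⟨((borelTriple σ J hJ).proj p : ↥(unitaryGroupOfForm σ J)), (borelTriple σ J hJ).M_le ((borelTriple σ J hJ).proj p).2⟩ with hm
  have hn : ((m⁻¹ * p : ↥(borelTriple σ J hJ).P) : ↥(unitaryGroupOfForm σ J)) ∈ unipotentU σ J :=
    (borelTriple σ J hJ).proj_inv_mul_mem p
  have hkill : χ (m⁻¹ * p) = 1 := by
    have h := map_eq_one_of_mem_unipotentU_two_of_eq σ hJ h2 h3 χ hn
    convert h using 2
  calc χ p = χ (m * (m⁻¹ * p)) := by rw [mul_inv_cancel_left]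
    _ = χ m := by rw [map_mul, hkill, mul_one]

end Characters

/-! ## §3 The CM Borel `B(L⁺_v) ≤ U(Φ₂)(L⁺_v)`: `δ_B|_N = 1`, Frobenius reciprocity for `i(χ₂)`, and J2 in `proj` form -/

section CM

variable (L : Type) [Field L] [NumberField L] [IsCMField L]

/-- **Every character of the Borel `B(L⁺_v)` of `U(Φ₂)(L⁺_v)` kills `N(L⁺_v)`.** [cite: Rogawski1990, §1.10 p. 9]
[cite: BernsteinZelevinsky1977, 1.8] -/
theorem map_eq_one_of_mem_cmUnipotentU_two (v : HeightOneSpectrum (𝓞 ↥(maximalRealSubfield L))) {C : Type*} [CommGroup C]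
    (χ : ↥(cmBorelTriple L 2 v).P →* C)
    {u : ↥(unitaryGroupOfForm (conjLocal L (IsCMField.complexConj L) v) (cmLocalForm L 2 v))}
    (hu : u ∈ unipotentU (conjLocal L (IsCMField.complexConj L) v) (cmLocalForm L 2 v)) :
    χ ⟨u, unipotentU_le_borelU _ _ hu⟩ = 1 :=
  map_eq_one_of_mem_unipotentU_two_of_eq (conjLocal L (IsCMField.complexConj L) v) (cmLocalForm_eq_over L 2 v)
    (isUnit_iff_exists_inv.2 ⟨fun w => (2 : w.1.adicCompletion L)⁻¹, funext fun _ => mul_inv_cancel₀ two_ne_zero⟩)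
    (isUnit_three_localRing L v) χ hu

/-- **`δ_B^{1/2}` is trivial on `N(L⁺_v)`** — the hypothesis of ★ `Representation.frobenius_normalizedInd` for the Borel of `U(Φ₂)(L⁺_v)`.
[cite: BernsteinZelevinsky1977, 1.8, §2.3] -/
theorem rootDeltaChar_cmBorel_two_eq_one (v : HeightOneSpectrum (𝓞 ↥(maximalRealSubfield L)))
    (n : ↥(unitaryGroupOfForm (conjLocal L (IsCMField.complexConj L) v) (cmLocalForm L 2 v))) (hn : n ∈ (cmBorelTriple L 2 v).N) :
    haveI := locallyCompactSpace_cmBorelU L 2 v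
    rootDeltaChar (cmBorelTriple L 2 v).P ⟨n, (cmBorelTriple L 2 v).N_le hn⟩ = 1 :=
  haveI := locallyCompactSpace_cmBorelU L 2 v
  map_eq_one_of_mem_cmUnipotentU_two L v (rootDeltaChar (cmBorelTriple L 2 v).P) hn

/-- **`δ_B` is trivial on `N(L⁺_v)`** for `U(Φ₂)(L⁺_v)` (the `hδ` of ★ `Representation.frobenius_normalizedInd`, verbatim shape).
[cite: BernsteinZelevinsky1977, 1.8] -/
theorem deltaChar_cmBorel_two_eq_one (v : HeightOneSpectrum (𝓞 ↥(maximalRealSubfield L)))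
    (n : ↥(unitaryGroupOfForm (conjLocal L (IsCMField.complexConj L) v) (cmLocalForm L 2 v))) (hn : n ∈ (cmBorelTriple L 2 v).N) :
    haveI := locallyCompactSpace_cmBorelU L 2 v
    deltaChar (cmBorelTriple L 2 v).P ⟨n, (cmBorelTriple L 2 v).N_le hn⟩ = 1 :=
  haveI := locallyCompactSpace_cmBorelU L 2 v
  map_eq_one_of_mem_cmUnipotentU_two L v (deltaChar (cmBorelTriple L 2 v).P) hn

/-- `δ_B^{1/2}(p) = δ_B^{1/2}(proj p)` on the Borel `B(L⁺_v)` of `U(Φ₂)(L⁺_v)`. [cite: BernsteinZelevinsky1977, 1.8] -/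
theorem rootDeltaChar_cmBorel_two_eq_proj (v : HeightOneSpectrum (𝓞 ↥(maximalRealSubfield L))) (p : ↥(cmBorelTriple L 2 v).P) :
    haveI := locallyCompactSpace_cmBorelU L 2 v
    rootDeltaChar (cmBorelTriple L 2 v).P p =
      rootDeltaChar (cmBorelTriple L 2 v).P ⟨((cmBorelTriple L 2 v).proj p : ↥(unitaryGroupOfForm _ _)),
        (cmBorelTriple L 2 v).M_le ((cmBorelTriple L 2 v).proj p).2⟩ :=
  haveI := locallyCompactSpace_cmBorelU L 2 v
  rootDeltaChar_eq_rootDeltaChar_proj (cmBorelTriple L 2 v) (rootDeltaChar_cmBorel_two_eq_one L v) p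

/-- **J2 in `proj` form for `U(Φ₂)(L⁺_v)`.**  A smooth `π` of `U(Φ₂)(L⁺_v)` with a functional `ℓ`, `ℓ w₀ ≠ 0`, equivariant for the character
`p ↦ χ₂ (proj p) · δ_B^{1/2} (proj p)` of `B(L⁺_v)` (the shape a Jacquet-module functional delivers), has a `G`-map `Φ : π → i(χ₂)` (★
`cmPrincipalSeries L 2 v χ₂`) with `Φ w₀ ≠ 0` and `(Φ w) g = ℓ (π g w)`. [cite: BernsteinZelevinsky1976, Proposition 2.28] [cite: Rogawski1990, §12.1 p. 171] -/
theorem exists_intertwiningMap_cmPrincipalSeries_two_of_functional_proj (v : HeightOneSpectrum (𝓞 ↥(maximalRealSubfield L)))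
    (χ₂ : ↥(torusU (conjLocal L (IsCMField.complexConj L) v) (cmLocalForm L 2 v)) →* ℂˣ)
    {V : Type*} [AddCommGroup V] [Module ℂ V]
    (π : Representation ℂ ↥(unitaryGroupOfForm (conjLocal L (IsCMField.complexConj L) v) (cmLocalForm L 2 v)) V)
    (hπ : π.IsSmooth) (ℓ : V →ₗ[ℂ] ℂ)
    (hℓ : haveI := locallyCompactSpace_cmBorelU L 2 v
      ∀ (p : ↥(cmBorelTriple L 2 v).P) (w : V),
        ℓ (π p.1 w) = ((χ₂ ((cmBorelTriple L 2 v).proj p) : ℂˣ) : ℂ) *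
          ((rootDeltaChar (cmBorelTriple L 2 v).P ⟨((cmBorelTriple L 2 v).proj p : ↥(unitaryGroupOfForm _ _)),
            (cmBorelTriple L 2 v).M_le ((cmBorelTriple L 2 v).proj p).2⟩ : ℂˣ) : ℂ) * ℓ w)
    (w₀ : V) (hw₀ : ℓ w₀ ≠ 0) :
    haveI := locallyCompactSpace_cmBorelU L 2 v
    ∃ Φ : π.IntertwiningMap (cmPrincipalSeries L 2 v χ₂),
      Φ w₀ ≠ 0 ∧ ∀ (w : V) (g : _), (Φ w).toFun g = ℓ (π g w) :=
  haveI := locallyCompactSpace_cmBorelU L 2 v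
  exists_intertwiningMap_normalizedInd_character_of_functional_proj (cmBorelTriple L 2 v) (rootDeltaChar_cmBorel_two_eq_one L v)
    χ₂ π hπ ℓ hℓ w₀ hw₀

end CM

end Summit.HodgeConjecture.HodgeConjecture.Cruxes.H413.F0P3bBorelCharactersUnipotentTwo

end
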